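import Literature.MathematicalPhysics.QuantumLattice.HubbardPolymerBounds
import HarnessLib

/-!
# Hubbard polymer weights for GENERAL bond couplings: representation, bounds, smallness

Ueltschi (1999), proof of Theorem 2.1 (i)–(ii) (§2.3 and p. 5 of the arXiv version): the polymer
representation of `Tr e^{-βH_Λ}` and its bounds only use that the "quantum interaction"
`T = (T_A)` is a sum of local terms with a norm `‖T‖_c`; in particular they apply verbatim to a
Hamiltonian with an ARBITRARY complex coupling `c_b` on every bond `b = (x, y, σ)` — e.g. the
Hubbard hopping `βt` on the bonds of the graph PLUS a source term `ε T_{b₀} = ε c†_{xσ} c_{yσ}` on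
one extra bond, which is how the expectation of the local observable `T_{b₀}` (the two-point
function of the fact `bgm_two_point_limit`) enters the expansion (`∂_ε log Tr e^{-βH + εT_{b₀}}`,
Ueltschi's `ρ_K`, proof of Thm. 2.1 (ii)). The tree's files `HubbardPolymerRepresentation.lean` /
`HubbardPolymerBounds.lean` are written for ONE coupling value `τ` on a bond set (`couplingOn τ K`,
`bondWeight β U μ τ K`, `siteActivity G β U μ τ`); this file redoes that layer for a coupling
FUNCTION `c : Bond Λ → ℂ` and an arbitrary finite set `D` of active bonds. Everything is PROVED:

* `couplingRestrict c K = c · 1_K` and the **general bond weight**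
  `couplingWeight β U μ c K = Σ_{K' ⊆ K} (-1)^{|K∖K'|} g(c · 1_{K'})` (`couplingWeight_eq_sum`),
  realised as the iterated unit-step difference of the entire function `z ↦ g(c · z)`
  (`g = gibbsRatio`, the normalised Gibbs factor `Zc(·)/Zc(0)` of `HubbardBondAlgebra`); it
  specialises to the tree's `bondWeight` at a constant coupling (`couplingWeight_const`), is `1`
  at `∅` and MULTIPLICATIVE over bond sets with disjoint supports (`couplingWeight_union`);
* the **polymer representation** for the active bond set `D`
  (`gibbsRatio_couplingRestrict_eq_polymerPartitionFunction`,
  `Zc_couplingRestrict_eq_mul_polymerPartitionFunction`):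
  `Zc(c · 1_D) = z₀^{|Λ|} · Ξ^{polyInc}_{𝒫(Λ)}(couplingActivity D c)` with the site activity
  `couplingActivity D β U μ c A = Σ_{X ⊆ D connected, supp X = A} couplingWeight c X`, which lives
  on supports of connected bond sets (`couplingActivity_eq_zero`,
  `isRConnected_bondRel_of_couplingActivity_ne_zero`);
* the **Cauchy bound** `norm_couplingWeight_le`: if `‖c_b‖ ≤ δ ≤ 1` on `K` then
  `|couplingWeight c K| ≤ (e² δ)^{|K|} r^{|supp K|}` (`r = siteRatio`, `= 1` at real `β, U, μ`) —
  the tree's `norm_iterDiff_zero_le` for `z ↦ g(c · z)` with step `1` and radius `1/δ`;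
* the **one-site Kotecký–Preiss smallness** `sum_norm_couplingActivity_mul_exp_le`: if every
  site lies on at most `m` bonds of `D`, `‖c_b‖ ≤ δ` on `D`, `0 < δ ≤ 1`, `r ≤ r₀` and
  `(2m+1)² λ ≤ 1/2` with `λ = e⁶ r₀² δ`, then `Σ_{A ∋ x} |couplingActivity D c A| e^{2|A|} ≤ 2mλ`
  (for `D = hubbardBonds G`, `m = 4Δ`, this is the tree's `sum_norm_siteActivity_mul_exp_le`).

## Mathlib / tree search

Tree (reused, not restated): `gibbsRatio`, `gibbsRatio_add`, `gibbsRatio_zero`, `bondWeight`,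
`couplingOn`, `endpoints_mem_cellSupp`, `union_sdiff_union_eq`, `verts_nonempty`
(`HubbardPolymerRepresentation`); `norm_gibbsRatio_le`, `differentiable_gibbsRatio`,
`norm_hopSum_le_mul_card`, `siteRatio`, `card_cellSupp_le` (`HubbardPolymerBounds`); `iterDiff`,
`norm_iterDiff_zero_le` (`IteratedDifferenceBound`); `pushforwardActivity`, `connectedCellSets`,
`sum_powerset_eq_polymerPartitionFunction_cellSupp`, `polymerPartitionFunction_eq_of_subset_of_eq_zero`
(`PolymerPushforward`); `sum_powerset_sum_powerset_neg_one_pow_card_sdiff_mul` (`ClusterExpansion`);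
`sum_pow_card_le_of_connected` (`PolymerGasGeometric`); `sum_biUnion_le_sum_of_nonneg`.

## References

* D. Ueltschi, J. Stat. Phys. 95 (1999) 693 (arXiv:cond-mat/9810320), §2.1 (quantum interactions
  `T = (T_A)` with norm `‖T‖_c`), §2.3 (polymer weights and their bound), proof of Thm. 2.1 (ii)
  p. 5 (the observable-decorated weight `ρ_K`), §3 (Hubbard bonds). [Ueltschi1999]
-/

noncomputable section

namespace Literature.MathematicalPhysics.QuantumLattice

open Matrix Finset HubbardWave0 Literature.Analysis.Complex.FiniteDifference Literature.Probability.LatticeModels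
open scoped BigOperators

/-! ### Restricting a coupling function to a bond set -/

section Restrict

variable {Λ : Type*} [LinearOrder Λ]

/-- The couplings `c` on the bonds of `K` and `0` elsewhere: `c · 1_K`. [folklore] -/
def couplingRestrict (c : Bond Λ → ℂ) (K : Finset (Bond Λ)) : Bond Λ → ℂ := Set.indicator (↑K : Set (Bond Λ)) c

/-- `c · 1_K` in coordinates. [folklore] -/
theorem couplingRestrict_apply (c : Bond Λ → ℂ) (K : Finset (Bond Λ)) (b : Bond Λ) :
    couplingRestrict c K b = if b ∈ K then c b else 0 := by
  rw [couplingRestrict, Set.indicator_apply]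
  simp only [Finset.mem_coe]

/-- `c · 1_K` is supported on `K`. [folklore] -/
theorem mem_of_couplingRestrict_ne_zero {c : Bond Λ → ℂ} {K : Finset (Bond Λ)} {b : Bond Λ}
    (h : couplingRestrict c K b ≠ 0) : b ∈ K := by
  rw [couplingRestrict_apply] at h
  by_contra hb
  exact h (if_neg hb)

/-- `c · 1_{K₁ ∪ K₂} = c · 1_{K₁} + c · 1_{K₂}` for disjoint bond sets. [folklore] -/
theorem couplingRestrict_union (c : Bond Λ → ℂ) {K₁ K₂ : Finset (Bond Λ)} (h : Disjoint K₁ K₂) :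
    couplingRestrict c (K₁ ∪ K₂) = couplingRestrict c K₁ + couplingRestrict c K₂ := by
  funext b
  simp only [Pi.add_apply, couplingRestrict_apply, Finset.mem_union]
  by_cases h1 : b ∈ K₁
  · have h2 : b ∉ K₂ := Finset.disjoint_left.1 h h1
    simp [h1, h2]
  · by_cases h2 : b ∈ K₂ <;> simp [h1, h2]

/-- The scaled indicator vector is the restriction: `c · (1_K) = c · 1_K` (pointwise product with
the indicator vector of `IteratedDifferenceBound`). [folklore] -/
theorem mul_indicator_one_eq_couplingRestrict (c : Bond Λ → ℂ) (K : Finset (Bond Λ)) :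
    c * Set.indicator (↑K : Set (Bond Λ)) 1 = couplingRestrict c K := by
  funext b
  rw [Pi.mul_apply, indicator_coe_apply, couplingRestrict_apply, mul_ite, mul_one, mul_zero]

/-- At a constant coupling the restriction is the tree's `couplingOn τ K = τ 1_K`. [folklore] -/
theorem couplingRestrict_const [Fintype Λ] (τ : ℂ) (K : Finset (Bond Λ)) :
    couplingRestrict (fun _ => τ) K = couplingOn τ K := by
  funext b
  rw [couplingRestrict_apply, couplingOn_apply]

/-- Restricting twice is restricting to the intersection; in particular `(c · 1_D) · 1_K = c · 1_K`
for `K ⊆ D`. [folklore] -/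
theorem couplingRestrict_couplingRestrict_of_subset (c : Bond Λ → ℂ) {K D : Finset (Bond Λ)} (h : K ⊆ D) :
    couplingRestrict (couplingRestrict c D) K = couplingRestrict c K := by
  funext b
  simp only [couplingRestrict_apply]
  by_cases hb : b ∈ K
  · simp [hb, h hb]
  · simp [hb]

end Restrict

/-! ### The bond weight of a coupling function -/

section Weights

variable {Λ : Type*} [LinearOrder Λ] [Fintype Λ]

/-- **The bond weight of a coupling function**: the iterated unit-step difference, in the
coordinates of `K`, of the entire function `z ↦ g(c · z)` at `0`, i.e.
`Σ_{K' ⊆ K} (-1)^{|K ∖ K'|} g(c · 1_{K'})` (`couplingWeight_eq_sum`). For a constant coupling this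
is the tree's `bondWeight` (`couplingWeight_const`). [cite: Ueltschi1999, §2.3 (definition of the polymer weights ρ(𝒜), for a general quantum interaction T)] -/
def couplingWeight (β U μ : ℂ) (c : Bond Λ → ℂ) (K : Finset (Bond Λ)) : ℂ :=
  iterDiff 1 K (fun z => gibbsRatio β U μ (c * z)) 0

/-- The bond weight as an explicit inclusion–exclusion sum. [folklore] -/
theorem couplingWeight_eq_sum (β U μ : ℂ) (c : Bond Λ → ℂ) (K : Finset (Bond Λ)) :
    couplingWeight β U μ c K =
      ∑ K' ∈ K.powerset, (-1) ^ (K \ K').card * gibbsRatio β U μ (couplingRestrict c K') := by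
  unfold couplingWeight iterDiff
  refine Finset.sum_congr rfl fun K' _ => ?_
  simp only [zero_add, one_smul, mul_indicator_one_eq_couplingRestrict]

/-- **Consistency with the tree's one-coupling weights**: `couplingWeight (fun _ => τ) = bondWeight τ`.
[folklore] -/
theorem couplingWeight_const (β U μ τ : ℂ) (K : Finset (Bond Λ)) :
    couplingWeight β U μ (fun _ => τ) K = bondWeight β U μ τ K := by
  rw [couplingWeight_eq_sum, bondWeight_eq_sum]
  refine Finset.sum_congr rfl fun K' _ => ?_
  rw [couplingRestrict_const]

/-- The weight of `K` only sees the couplings on `K`. [folklore] -/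
theorem couplingWeight_couplingRestrict_of_subset (β U μ : ℂ) (c : Bond Λ → ℂ) {K D : Finset (Bond Λ)}
    (h : K ⊆ D) : couplingWeight β U μ (couplingRestrict c D) K = couplingWeight β U μ c K := by
  rw [couplingWeight_eq_sum, couplingWeight_eq_sum]
  refine Finset.sum_congr rfl fun K' hK' => ?_
  rw [couplingRestrict_couplingRestrict_of_subset c ((Finset.mem_powerset.1 hK').trans h)]

variable {β U μ : ℂ}

/-- `couplingWeight c ∅ = 1` (`z₀ ≠ 0`). [folklore] -/
theorem couplingWeight_empty (hz : atomicPartitionFn β U μ ≠ 0) (c : Bond Λ → ℂ) :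
    couplingWeight β U μ c (∅ : Finset (Bond Λ)) = 1 := by
  rw [couplingWeight, iterDiff_empty, mul_zero, gibbsRatio_zero hz]

/-- **Multiplicativity**: `couplingWeight c (K₁ ∪ K₂) = couplingWeight c K₁ · couplingWeight c K₂`
whenever the supports of `K₁`, `K₂` are disjoint (inclusion–exclusion of the multiplicative
function `K' ↦ g(c · 1_{K'})`, `gibbsRatio_add`). [cite: Ueltschi1999, §2.3 (ρ factorises over the connected components)] -/
theorem couplingWeight_union (hz : atomicPartitionFn β U μ ≠ 0) (c : Bond Λ → ℂ) {K₁ K₂ : Finset (Bond Λ)}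
    (h : Disjoint (cellSupp Bond.verts K₁) (cellSupp Bond.verts K₂)) :
    couplingWeight β U μ c (K₁ ∪ K₂) = couplingWeight β U μ c K₁ * couplingWeight β U μ c K₂ := by
  have hK : Disjoint K₁ K₂ := disjoint_of_disjoint_cellSupp h
  rw [couplingWeight_eq_sum, couplingWeight_eq_sum, couplingWeight_eq_sum, sum_powerset_union_eq_sum_sum hK,
    Finset.sum_mul_sum]
  refine Finset.sum_congr rfl fun K₁' h₁ => Finset.sum_congr rfl fun K₂' h₂ => ?_
  have h₁' : K₁' ⊆ K₁ := Finset.mem_powerset.1 h₁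
  have h₂' : K₂' ⊆ K₂ := Finset.mem_powerset.1 h₂
  have hK' : Disjoint K₁' K₂' := Finset.disjoint_of_subset_left h₁' (Finset.disjoint_of_subset_right h₂' hK)
  have hsd : Disjoint (K₁ \ K₁') (K₂ \ K₂') :=
    Finset.disjoint_of_subset_left Finset.sdiff_subset (Finset.disjoint_of_subset_right Finset.sdiff_subset hK)
  have hc₁ : ∀ b, couplingRestrict c K₁' b ≠ 0 → b.1 ∈ cellSupp Bond.verts K₁ ∧ b.2.1 ∈ cellSupp Bond.verts K₁ :=
    fun b hb => endpoints_mem_cellSupp (h₁' (mem_of_couplingRestrict_ne_zero hb))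
  have hc₂ : ∀ b, couplingRestrict c K₂' b ≠ 0 → b.1 ∈ cellSupp Bond.verts K₂ ∧ b.2.1 ∈ cellSupp Bond.verts K₂ :=
    fun b hb => endpoints_mem_cellSupp (h₂' (mem_of_couplingRestrict_ne_zero hb))
  rw [union_sdiff_union_eq hK h₁' h₂', Finset.card_union_of_disjoint hsd, pow_add, couplingRestrict_union c hK',
    gibbsRatio_add hz h hc₁ hc₂]
  ring

end Weights

/-! ### The polymer representation for an arbitrary active bond set -/

section Representation

variable {Λ : Type*} [LinearOrder Λ] [Fintype Λ] (D : Finset (Bond Λ))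

/-- **The site activity of the active bond set `D` and the couplings `c`**:
`ρ(A) = Σ_{X ⊆ D connected, supp X = A} couplingWeight c X`. [cite: Ueltschi1999, §2.3 (weights ρ(𝒜)) and §3 (polymers are connected sets)] -/
def couplingActivity (β U μ : ℂ) (c : Bond Λ → ℂ) : Finset Λ → ℂ :=
  pushforwardActivity (cellSupp Bond.verts) (couplingWeight β U μ c) (connectedCellSets Bond.verts D)

variable {D}

/-- The site activity unfolded. [folklore] -/
theorem couplingActivity_apply (β U μ : ℂ) (c : Bond Λ → ℂ) (A : Finset Λ) :
    couplingActivity D β U μ c A =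
      ∑ X ∈ (connectedCellSets Bond.verts D).filter (fun X => cellSupp Bond.verts X = A),
        couplingWeight β U μ c X := rfl

/-- The site activity only sees the couplings on `D`. [folklore] -/
theorem couplingActivity_couplingRestrict (β U μ : ℂ) (c : Bond Λ → ℂ) :
    couplingActivity D β U μ (couplingRestrict c D) = couplingActivity D β U μ c := by
  funext A
  rw [couplingActivity_apply, couplingActivity_apply]
  refine Finset.sum_congr rfl fun X hX => ?_
  exact couplingWeight_couplingRestrict_of_subset β U μ c (mem_connectedCellSets.1 (Finset.mem_filter.1 hX).1).1

/-- At a constant coupling on the bonds of a graph the site activity is the tree's `siteActivity`.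
[folklore] -/
theorem couplingActivity_const (G : SimpleGraph Λ) [DecidableRel G.Adj] (β U μ τ : ℂ) :
    couplingActivity (hubbardBonds G) β U μ (fun _ => τ) = siteActivity G β U μ τ := by
  funext A
  rw [couplingActivity_apply, siteActivity_apply]
  exact Finset.sum_congr rfl fun X _ => couplingWeight_const β U μ τ X

variable {β U μ : ℂ}

/-- **The polymer representation of the normalised Gibbs factor** for the active bond set `D`:
`g(c · 1_D) = Ξ^{polyInc}_{𝒫(Λ)}(couplingActivity D c)` (`z₀ ≠ 0`): Möbius inversion over the
subsets of `D`, decomposition into connected components, pushforward along the support map.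
[cite: Ueltschi1999, §2.3 (Tr e^{-βH_Λ} = e^{-βf₀|Λ|} Σ_{𝒜₁,…,𝒜_ℓ disjoint} Π ρ(𝒜_j))] -/
theorem gibbsRatio_couplingRestrict_eq_polymerPartitionFunction (hz : atomicPartitionFn β U μ ≠ 0)
    (c : Bond Λ → ℂ) :
    gibbsRatio β U μ (couplingRestrict c D) =
      polymerPartitionFunction polyInc (couplingActivity D β U μ c) (Finset.univ : Finset Λ).powerset := by
  -- Möbius inversion over the bond sets
  have h2 : gibbsRatio β U μ (couplingRestrict c D) = ∑ K ∈ D.powerset, couplingWeight β U μ c K := by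
    simp_rw [couplingWeight_eq_sum]
    exact (sum_powerset_sum_powerset_neg_one_pow_card_sdiff_mul (M := ℂ)
      (fun K => gibbsRatio β U μ (couplingRestrict c K)) D).symm
  -- components and pushforward to site polymers
  have h3 := sum_powerset_eq_polymerPartitionFunction_cellSupp (verts := (Bond.verts : Bond Λ → Finset Λ))
    verts_nonempty (couplingWeight β U μ c) (couplingWeight_empty hz c)
    (fun K₁ K₂ h => couplingWeight_union hz c h) D
  -- enlarge the volume to all subsets (the new polymers have zero activity)
  have h4 : polymerPartitionFunction polyInc (couplingActivity D β U μ c) (Finset.univ : Finset Λ).powerset =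
      polymerPartitionFunction polyInc (couplingActivity D β U μ c)
        ((connectedCellSets Bond.verts D).image (cellSupp Bond.verts)) :=
    polymerPartitionFunction_eq_of_subset_of_eq_zero (fun A _ => Finset.mem_powerset.2 (Finset.subset_univ _))
      fun A _ hA => pushforwardActivity_eq_zero_of_not_mem_image hA
  rw [h2, h3, h4, couplingActivity]

/-- **The polymer representation of the Gibbs factor** for the active bond set `D`:
`Zc(c · 1_D) = z₀^{|Λ|} · Ξ^{polyInc}_{𝒫(Λ)}(couplingActivity D c)` (`z₀ ≠ 0`).
[cite: Ueltschi1999, §2.3 (polymer form of Tr e^{-βH_Λ})] -/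
theorem Zc_couplingRestrict_eq_mul_polymerPartitionFunction (hz : atomicPartitionFn β U μ ≠ 0)
    (c : Bond Λ → ℂ) :
    Zc β U μ (couplingRestrict c D) =
      atomicPartitionFn β U μ ^ Fintype.card Λ *
        polymerPartitionFunction polyInc (couplingActivity D β U μ c) (Finset.univ : Finset Λ).powerset := by
  have h0 : Zc β U μ (0 : Bond Λ → ℂ) ≠ 0 := Zc_zero_ne_zero hz
  have h1 : Zc β U μ (couplingRestrict c D) = Zc β U μ (0 : Bond Λ → ℂ) * gibbsRatio β U μ (couplingRestrict c D) := by
    rw [gibbsRatio, mul_div_cancel₀ _ h0]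
  rw [h1, gibbsRatio_couplingRestrict_eq_polymerPartitionFunction hz, Zc_zero]

/-! ### Support properties of the site activity -/

/-- The site activity of `A` vanishes unless `A` is the support of a connected subset of `D`.
[folklore] -/
theorem couplingActivity_eq_zero (c : Bond Λ → ℂ) {A : Finset Λ}
    (hA : ∀ X ⊆ D, IsRConnected (ShareVertex Bond.verts) X → cellSupp Bond.verts X ≠ A) :
    couplingActivity D β U μ c A = 0 :=
  pushforwardActivity_cellSupp_eq_zero hA

/-- Two sites are joined by a bond of `D`. [folklore] -/
def BondRel (D : Finset (Bond Λ)) (u v : Λ) : Prop := ∃ b ∈ D, u ∈ Bond.verts b ∧ v ∈ Bond.verts b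

omit [Fintype Λ] in
/-- `BondRel` is symmetric. [folklore] -/
theorem bondRel_symm {D : Finset (Bond Λ)} {u v : Λ} (h : BondRel D u v) : BondRel D v u := by
  obtain ⟨b, hb, hu, hv⟩ := h
  exact ⟨b, hb, hv, hu⟩

omit [Fintype Λ] in
/-- `BondRel` is monotone in the bond set. [folklore] -/
theorem bondRel_mono {D D' : Finset (Bond Λ)} (h : D ⊆ D') {u v : Λ} (huv : BondRel D u v) : BondRel D' u v := by
  obtain ⟨b, hb, hu, hv⟩ := huv
  exact ⟨b, h hb, hu, hv⟩

omit [Fintype Λ] in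
/-- The support of a connected set of bonds of `D` is `BondRel D`-connected. [folklore] -/
theorem isRConnected_bondRel_cellSupp {X : Finset (Bond Λ)} (hXD : X ⊆ D)
    (hX : IsRConnected (ShareVertex Bond.verts) X) : IsRConnected (BondRel D) (cellSupp Bond.verts X) := by
  classical
  set S := cellSupp Bond.verts X with hS
  -- the vertices of a bond of `X` are joined inside `S`
  have hbond : ∀ b ∈ X, ∀ u ∈ Bond.verts b, ∀ v ∈ Bond.verts b,
      Relation.ReflTransGen (fun x y => BondRel D x y ∧ x ∈ S ∧ y ∈ S) u v := by
    intro b hb u hu v hv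
    exact Relation.ReflTransGen.single ⟨⟨b, hXD hb, hu, hv⟩, mem_cellSupp.2 ⟨b, hb, hu⟩, mem_cellSupp.2 ⟨b, hb, hv⟩⟩
  -- along a chain of bonds sharing vertices, any vertex of the first is joined to any vertex of the last
  have hchain : ∀ b b' : Bond Λ, Relation.ReflTransGen (fun c d => ShareVertex Bond.verts c d ∧ c ∈ X ∧ d ∈ X) b b' →
      b ∈ X → ∀ u ∈ Bond.verts b, ∀ v ∈ Bond.verts b',
        Relation.ReflTransGen (fun x y => BondRel D x y ∧ x ∈ S ∧ y ∈ S) u v := by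
    intro b b' hbb' hb
    induction hbb' with
    | refl => exact fun u hu v hv => hbond b hb u hu v hv
    | @tail c d _ hcd ih =>
      intro u hu v hv
      obtain ⟨⟨w, hw⟩, _, hd⟩ := hcd
      obtain ⟨hwc, hwd⟩ := Finset.mem_inter.1 hw
      exact (ih u hu w hwc).trans (hbond d hd w hwd v hv)
  obtain ⟨hne, hconn⟩ := hX
  refine ⟨cellSupp_nonempty verts_nonempty hne, fun u hu v hv => ?_⟩
  obtain ⟨b, hb, hub⟩ := mem_cellSupp.1 hu
  obtain ⟨b', hb', hvb'⟩ := mem_cellSupp.1 hv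
  exact hchain b b' (hconn b hb b' hb') hb u hub v hvb'

/-- **The site activity lives on `BondRel D`-connected site sets.** [cite: Ueltschi1999, §3 ("our polymers are now connected sets")] -/
theorem isRConnected_bondRel_of_couplingActivity_ne_zero {c : Bond Λ → ℂ} {A : Finset Λ}
    (hA : couplingActivity D β U μ c A ≠ 0) : IsRConnected (BondRel D) A := by
  by_contra hcon
  refine hA (couplingActivity_eq_zero c fun X hXD hX hXA => hcon ?_)
  rw [← hXA]
  exact isRConnected_bondRel_cellSupp hXD hX

end Representation

/-! ### The Cauchy bound on the bond weight of a coupling function -/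

section Bounds

variable {Λ : Type*} [LinearOrder Λ] [Fintype Λ] {β U μ : ℂ}

/-- `z ↦ g(c · z)` is entire. [folklore] -/
theorem differentiable_gibbsRatio_mul (β U μ : ℂ) (c : Bond Λ → ℂ) :
    Differentiable ℂ fun z : Bond Λ → ℂ => gibbsRatio β U μ (c * z) :=
  (differentiable_gibbsRatio β U μ).comp ((differentiable_const c).mul differentiable_id)

/-- **Smallness per bond for a coupling function**: if `‖c_b‖ ≤ δ` for `b ∈ K` with `0 < δ ≤ 1`,
then `|couplingWeight c K| ≤ (e² δ)^{|K|} · r^{|supp K|}` (Cauchy bound for the unit-step iterated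
difference of `z ↦ g(c · z)` with radius `1/δ`: on that polydisc the couplings `c · z` are
supported in `K` and bounded by `δ + 1`, so `‖Σ (c·z)_b T_b‖ ≤ (δ+1)|K|` and
`δ^{|K|} e^{(δ+1)|K|} ≤ (e²δ)^{|K|}`). [cite: Ueltschi1999, §2.3 (|ρ(𝒜)| ≤ e^{-(c - log S - 1)‖𝒜‖} from ‖T‖_c)] -/
theorem norm_couplingWeight_le (hz : atomicPartitionFn β U μ ≠ 0) {δ : ℝ} (hδ0 : 0 < δ) (hδ1 : δ ≤ 1)
    {c : Bond Λ → ℂ} {K : Finset (Bond Λ)} (hc : ∀ b ∈ K, ‖c b‖ ≤ δ) :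
    ‖couplingWeight β U μ c K‖ ≤
      (Real.exp 2 * δ) ^ K.card * siteRatio β U μ ^ (cellSupp Bond.verts K).card := by
  have hR : (0 : ℝ) < 1 / δ := by positivity
  have hB : ∀ z : Bond Λ → ℂ, (∀ b, ‖z b‖ ≤ ‖(1 : ℂ)‖ + 1 / δ) → (∀ b ∉ K, z b = 0) →
      ‖gibbsRatio β U μ (c * z)‖ ≤ Real.exp ((δ + 1) * K.card) * siteRatio β U μ ^ (cellSupp Bond.verts K).card := by
    intro z hz' hK
    have hK' : ∀ b ∉ K, (c * z) b = 0 := fun b hb => by rw [Pi.mul_apply, hK b hb, mul_zero]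
    have hsupp : ∀ b, (c * z) b ≠ 0 → b.1 ∈ cellSupp Bond.verts K ∧ b.2.1 ∈ cellSupp Bond.verts K := by
      intro b hb
      have hbK : b ∈ K := by by_contra h; exact hb (hK' b h)
      exact endpoints_mem_cellSupp hbK
    have hcz : ∀ b, ‖(c * z) b‖ ≤ δ + 1 := by
      intro b
      by_cases hbK : b ∈ K
      · rw [Pi.mul_apply, norm_mul]
        calc ‖c b‖ * ‖z b‖ ≤ δ * (‖(1 : ℂ)‖ + 1 / δ) :=
              mul_le_mul (hc b hbK) (hz' b) (norm_nonneg _) hδ0.le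
          _ = δ + 1 := by rw [norm_one]; field_simp
      · rw [hK' b hbK, norm_zero]; positivity
    refine (norm_gibbsRatio_le hz hsupp).trans (mul_le_mul_of_nonneg_right ?_ (pow_nonneg (siteRatio_nonneg _ _ _) _))
    rw [Real.exp_le_exp]
    exact norm_hopSum_le_mul_card hcz hK'
  have h := norm_iterDiff_zero_le (differentiable_gibbsRatio_mul β U μ c) hR K hB
  rw [couplingWeight]
  refine h.trans ?_
  rw [norm_one, one_div_one_div, ← mul_assoc]
  refine mul_le_mul_of_nonneg_right ?_ (pow_nonneg (siteRatio_nonneg _ _ _) _)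
  rw [mul_pow, mul_comm (Real.exp 2 ^ K.card), show (δ + 1) * (K.card : ℝ) = (K.card : ℝ) * (δ + 1) by ring,
    Real.exp_nat_mul]
  refine mul_le_mul_of_nonneg_left (pow_le_pow_left₀ (Real.exp_nonneg _) ?_ _) (pow_nonneg hδ0.le _)
  exact Real.exp_le_exp.2 (by linarith)

/-- A bond of `K` with zero coupling kills the weight: the function `z ↦ g(c · z)` does not depend
on that coordinate, so its difference in it vanishes. [folklore] -/
theorem couplingWeight_eq_zero_of_apply_eq_zero {c : Bond Λ → ℂ} {K : Finset (Bond Λ)} {b : Bond Λ}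
    (hb : b ∈ K) (hcb : c b = 0) : couplingWeight β U μ c K = 0 := by
  classical
  rw [couplingWeight, ← Finset.insert_erase hb, iterDiff_insert 1 (Finset.notMem_erase b K)]
  have hconst : fwdDiff ((1 : ℂ) • (Pi.single b 1 : Bond Λ → ℂ)) (fun z : Bond Λ → ℂ => gibbsRatio β U μ (c * z)) =
      fun _ => 0 := by
    funext z
    rw [fwdDiff, sub_eq_zero]
    congr 1
    funext b'
    rw [Pi.mul_apply, Pi.mul_apply, Pi.add_apply]
    by_cases h : b' = b
    · subst h; rw [hcb, zero_mul, zero_mul]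
    · rw [Pi.smul_apply, Pi.single_eq_of_ne h, smul_zero, add_zero]
  rw [hconst, iterDiff]
  simp

end Bounds

/-! ### Counting bonds of an arbitrary bond set at a site -/

section Counting

variable {Λ : Type*} [DecidableEq Λ] {D : Finset (Bond Λ)} {m : ℕ}

/-- If every site lies on at most `m` bonds of `D`, at most `2m` bonds of `D` share a site with a
given bond. [folklore] -/
theorem card_filter_shareVertex_le (hm : ∀ v : Λ, (D.filter fun b => v ∈ Bond.verts b).card ≤ m) (b₀ : Bond Λ) :
    (D.filter fun b => ShareVertex Bond.verts b₀ b).card ≤ 2 * m := by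
  have hsub : D.filter (fun b => ShareVertex Bond.verts b₀ b) ⊆
      (Bond.verts b₀).biUnion fun v => D.filter fun b => v ∈ Bond.verts b := by
    intro b hb
    obtain ⟨hbD, ⟨v, hv⟩⟩ := Finset.mem_filter.1 hb
    obtain ⟨hv₀, hvb⟩ := Finset.mem_inter.1 hv
    exact Finset.mem_biUnion.2 ⟨v, hv₀, Finset.mem_filter.2 ⟨hbD, hvb⟩⟩
  have hcard₀ : (Bond.verts b₀).card ≤ 2 := Finset.card_insert_le _ _
  calc (D.filter fun b => ShareVertex Bond.verts b₀ b).card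
      ≤ ((Bond.verts b₀).biUnion fun v => D.filter fun b => v ∈ Bond.verts b).card := Finset.card_le_card hsub
    _ ≤ ∑ v ∈ Bond.verts b₀, (D.filter fun b => v ∈ Bond.verts b).card := Finset.card_biUnion_le
    _ ≤ ∑ _v ∈ Bond.verts b₀, m := Finset.sum_le_sum fun v _ => hm v
    _ = (Bond.verts b₀).card * m := by rw [Finset.sum_const, smul_eq_mul]
    _ ≤ 2 * m := Nat.mul_le_mul_right _ hcard₀

/-- For the bonds of a graph of maximal degree `Δ` one may take `m = 4Δ`. [folklore] -/
theorem card_hubbardBonds_filter_mem_verts_le {Λ : Type*} [LinearOrder Λ] [Fintype Λ] {G : SimpleGraph Λ}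
    [DecidableRel G.Adj] {Δ : ℕ} (hΔ : ∀ v : Λ, (Finset.univ.filter (G.Adj v)).card ≤ Δ) (v : Λ) :
    ((hubbardBonds G).filter fun b => v ∈ Bond.verts b).card ≤ 4 * Δ :=
  card_hubbardBonds_mem_verts_le hΔ v

end Counting

/-! ### The Kotecký–Preiss smallness of the site activity of a coupling function -/

section Smallness

variable {Λ : Type*} [LinearOrder Λ] [Fintype Λ] {β U μ : ℂ} {D : Finset (Bond Λ)} {m : ℕ}

omit [Fintype Λ] in
/-- **Entropy of connected subsets of `D` through a bond**: if every site lies on at most `m` bonds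
of `D`, then for `λ ≥ 0` with `(2m+1)² λ ≤ 1/2`, `Σ_{X ⊆ D connected, X ∋ b₀} λ^{|X|} ≤ 2λ`.
[cite: Ueltschi1999, §2.3 (the constant ℶ)] -/
theorem sum_pow_card_connectedCellSets_le_of_card_le (hm : ∀ v : Λ, (D.filter fun b => v ∈ Bond.verts b).card ≤ m)
    {lam : ℝ} (hlam : 0 ≤ lam) (hsmall : ((2 * m : ℕ) + 1 : ℝ) ^ 2 * lam ≤ 1 / 2) (b₀ : Bond Λ) :
    ∑ X ∈ (connectedCellSets Bond.verts D).filter (fun X => b₀ ∈ X), lam ^ X.card ≤ 2 * lam := by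
  classical
  set R : Bond Λ → Bond Λ → Prop := fun b b' => ShareVertex Bond.verts b b' ∧ b ∈ D ∧ b' ∈ D with hR
  have hRs : ∀ b b', R b b' → R b' b := fun b b' ⟨h, hb, hb'⟩ => ⟨shareVertex_symm _ _ h, hb', hb⟩
  set nbr : Bond Λ → Finset (Bond Λ) := fun b => D.filter fun b' => ShareVertex Bond.verts b b' with hnbr
  have hΔ' : ∀ b, (nbr b).card ≤ 2 * m := fun b => card_filter_shareVertex_le hm b
  have hnbr' : ∀ b b', R b b' → b' ∈ nbr b := fun b b' ⟨h, _, hb'⟩ => Finset.mem_filter.2 ⟨hb', h⟩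
  have hsmall' : (((2 * m : ℕ) : ℝ) + 1) ^ 2 * lam ≤ 1 / 2 := by exact_mod_cast hsmall
  refine sum_pow_card_le_of_connected (R := R) (nbr := nbr) (Δ := 2 * m) hRs hΔ' hnbr' hlam hsmall' b₀ _ ?_
  intro X hX
  obtain ⟨hX, hb₀⟩ := Finset.mem_filter.1 hX
  obtain ⟨hXD, hXc⟩ := mem_connectedCellSets.1 hX
  obtain ⟨hne, hconn⟩ := hXc
  refine ⟨hb₀, hne, fun v hv w hw => ?_⟩
  exact Relation.ReflTransGen.mono (fun a b (h : ShareVertex Bond.verts a b ∧ a ∈ X ∧ b ∈ X) =>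
    (⟨⟨h.1, hXD h.2.1, hXD h.2.2⟩, h.2.1, h.2.2⟩ : R a b ∧ a ∈ X ∧ b ∈ X)) _ _ (hconn v hv w hw)

/-- **One-site Kotecký–Preiss smallness of the site activity of a coupling function**: if every
site lies on at most `m` bonds of `D`, `‖c_b‖ ≤ δ` on `D` with `0 < δ ≤ 1`, `r ≤ r₀` with
`1 ≤ r₀`, and `(2m+1)² λ ≤ 1/2` where `λ = e⁶ r₀² δ`, then for every site `x` and every finite
family `𝒜` of site sets containing `x`, `Σ_{A ∈ 𝒜} |couplingActivity D c A| e^{2|A|} ≤ 2mλ`.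
[cite: Ueltschi1999, §3 (|ρ(𝒜)| ≤ e^{-c|𝒜|} when 2χ e^{c+1} βt ≤ 1) and §2.3] -/
theorem sum_norm_couplingActivity_mul_exp_le (hm : ∀ v : Λ, (D.filter fun b => v ∈ Bond.verts b).card ≤ m)
    (hz : atomicPartitionFn β U μ ≠ 0) {r₀ : ℝ} (hr₀ : 1 ≤ r₀) (hr : siteRatio β U μ ≤ r₀)
    {δ : ℝ} (hδ0 : 0 < δ) (hδ1 : δ ≤ 1) {c : Bond Λ → ℂ} (hc : ∀ b ∈ D, ‖c b‖ ≤ δ)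
    (hsmall : ((2 * m : ℕ) + 1 : ℝ) ^ 2 * (Real.exp 6 * r₀ ^ 2 * δ) ≤ 1 / 2)
    (x : Λ) (𝒜 : Finset (Finset Λ)) (h𝒜 : ∀ A ∈ 𝒜, x ∈ A) :
    ∑ A ∈ 𝒜, ‖couplingActivity D β U μ c A‖ * Real.exp (2 * A.card) ≤ 2 * m * (Real.exp 6 * r₀ ^ 2 * δ) := by
  classical
  set lam : ℝ := Real.exp 6 * r₀ ^ 2 * δ with hlam
  have hlam0 : 0 ≤ lam := by positivity
  set CC := connectedCellSets Bond.verts D with hCC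
  set f : Finset (Bond Λ) → ℝ := fun X => ‖couplingWeight β U μ c X‖ * Real.exp (2 * (cellSupp Bond.verts X).card)
    with hf
  have hf0 : ∀ X, 0 ≤ f X := fun X => by positivity
  -- Step a: bound by a sum over connected bond sets through `x`
  set Sx := CC.filter fun X => x ∈ cellSupp Bond.verts X with hSx
  have stepA : ∑ A ∈ 𝒜, ‖couplingActivity D β U μ c A‖ * Real.exp (2 * A.card) ≤ ∑ X ∈ Sx, f X := by
    have h1 : ∀ A ∈ 𝒜, ‖couplingActivity D β U μ c A‖ * Real.exp (2 * A.card) ≤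
        ∑ X ∈ CC.filter (fun X => cellSupp Bond.verts X = A), f X := by
      intro A _
      rw [couplingActivity_apply, ← hCC]
      refine (mul_le_mul_of_nonneg_right (norm_sum_le _ _) (Real.exp_nonneg _)).trans ?_
      rw [Finset.sum_mul]
      refine Finset.sum_le_sum fun X hX => le_of_eq ?_
      simp only [hf]
      rw [(Finset.mem_filter.1 hX).2]
    refine (Finset.sum_le_sum h1).trans ?_
    rw [← Finset.sum_biUnion]
    · refine Finset.sum_le_sum_of_subset_of_nonneg ?_ fun X _ _ => hf0 X
      intro X hX
      obtain ⟨A, hA, hXA⟩ := Finset.mem_biUnion.1 hX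
      obtain ⟨hXCC, hXsupp⟩ := Finset.mem_filter.1 hXA
      exact Finset.mem_filter.2 ⟨hXCC, hXsupp ▸ h𝒜 A hA⟩
    · intro A hA B hB hAB
      refine Finset.disjoint_left.2 fun X hXA hXB => hAB ?_
      rw [← (Finset.mem_filter.1 hXA).2, ← (Finset.mem_filter.1 hXB).2]
  -- Step b: each term is at most `λ^{|X|}`
  have stepB : ∀ X ∈ Sx, f X ≤ lam ^ X.card := by
    intro X hX
    have hXD : X ⊆ D := (mem_connectedCellSets.1 (Finset.mem_filter.1 hX).1).1
    have hb := norm_couplingWeight_le hz hδ0 hδ1 (K := X) fun b hb => hc b (hXD hb)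
    have hs := card_cellSupp_le X
    set k := X.card
    set n := (cellSupp Bond.verts X).card
    have hr0 := siteRatio_nonneg β U μ
    calc f X ≤ (Real.exp 2 * δ) ^ k * siteRatio β U μ ^ n * Real.exp (2 * n) :=
          mul_le_mul_of_nonneg_right hb (Real.exp_nonneg _)
      _ ≤ (Real.exp 2 * δ) ^ k * r₀ ^ n * Real.exp (2 * n) := by gcongr
      _ = (Real.exp 2 * δ) ^ k * (r₀ * Real.exp 2) ^ n := by
          rw [show (2 : ℝ) * n = (n : ℝ) * 2 by ring, Real.exp_nat_mul]; ring
      _ ≤ (Real.exp 2 * δ) ^ k * (r₀ * Real.exp 2) ^ (2 * k) := by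
          refine mul_le_mul_of_nonneg_left (pow_le_pow_right₀ ?_ hs) (by positivity)
          have : (1 : ℝ) ≤ Real.exp 2 := Real.one_le_exp two_pos.le
          nlinarith
      _ = lam ^ k := by
          rw [hlam, pow_mul, ← mul_pow]
          congr 1
          have h6 : Real.exp 6 = Real.exp 2 ^ 3 := by
            rw [← Real.exp_nat_mul]; norm_num
          rw [h6]; ring
  -- Step c: cover `Sx` by the families through the bonds at `x`
  set Bx := D.filter fun b => x ∈ Bond.verts b with hBx
  have hcover : Sx ⊆ Bx.biUnion fun b₀ => CC.filter fun X => b₀ ∈ X := by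
    intro X hX
    obtain ⟨hXCC, hx⟩ := Finset.mem_filter.1 hX
    obtain ⟨b₀, hb₀X, hxb₀⟩ := mem_cellSupp.1 hx
    have hb₀D : b₀ ∈ D := (mem_connectedCellSets.1 hXCC).1 hb₀X
    exact Finset.mem_biUnion.2 ⟨b₀, Finset.mem_filter.2 ⟨hb₀D, hxb₀⟩, Finset.mem_filter.2 ⟨hXCC, hb₀X⟩⟩
  have stepC : ∑ X ∈ Sx, lam ^ X.card ≤ ∑ b₀ ∈ Bx, ∑ X ∈ CC.filter (fun X => b₀ ∈ X), lam ^ X.card :=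
    (Finset.sum_le_sum_of_subset_of_nonneg hcover fun X _ _ => pow_nonneg hlam0 _).trans
      (sum_biUnion_le_sum_of_nonneg Bx _ _ fun X => pow_nonneg hlam0 _)
  -- Step d/e: entropy bound and the number of bonds at `x`
  have stepD : ∀ b₀ ∈ Bx, ∑ X ∈ CC.filter (fun X => b₀ ∈ X), lam ^ X.card ≤ 2 * lam :=
    fun b₀ _ => sum_pow_card_connectedCellSets_le_of_card_le hm hlam0 hsmall b₀
  have stepE : (Bx.card : ℝ) ≤ m := by exact_mod_cast hm x
  calc ∑ A ∈ 𝒜, ‖couplingActivity D β U μ c A‖ * Real.exp (2 * A.card)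
      ≤ ∑ X ∈ Sx, f X := stepA
    _ ≤ ∑ X ∈ Sx, lam ^ X.card := Finset.sum_le_sum stepB
    _ ≤ ∑ b₀ ∈ Bx, ∑ X ∈ CC.filter (fun X => b₀ ∈ X), lam ^ X.card := stepC
    _ ≤ ∑ _b₀ ∈ Bx, 2 * lam := Finset.sum_le_sum stepD
    _ = Bx.card * (2 * lam) := by rw [Finset.sum_const, nsmul_eq_mul]
    _ ≤ m * (2 * lam) := mul_le_mul_of_nonneg_right stepE (by positivity)
    _ = 2 * m * lam := by ring

end Smallness

end Literature.MathematicalPhysics.QuantumLattice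

end
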